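import Summits.ABC.ABC.Theorems.CongruentialReceptacleTameLocalReceptacleKeyCellDefs
import Literature.NumberTheory.LFunctions.GRHSmoothEulerProductLindelof

/-!
# Crux `CongruentialReceptacle.TameLocalReceptacle` (stmt-ABC-14354), line `grh-friable-cell-resolution`:
# stub `stub_smoothLLindelof_of_grh` (GRH ⇒ Lindelöf for the partial Euler products)

Registered stub of the checked skeleton `Cruxes/TameLocalReceptacle/Lines/grh_friable_cell_resolution.lean`
(lead `prover-line-stmt-ABC-14354-a1-0`): `GeneralizedRiemannHypothesis → SmoothLLindelof`, i.e. under GRH,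
for every `ε > 0` there is `C` with `‖L(s, χ; y)‖ ≤ C (q(1 + |Im s|))^ε` for all `q ≠ 0`, all non-principal
`χ` mod `q`, all `y` and all `Re s ≥ 1/2 + ε` (`L(s, χ; y) = ∏_{p ≤ y}(1 − χ(p)p^{-s})⁻¹ =
TwistedWeight.smoothLC`; Lagarias–Soundararajan, Proc. LMS 104 (2012), Prop. 5.1).

This is a DERIVATION from the tree, not a vendored fact: the whole proof is the Literature chain
`GRHTwistedCharacterPrimeSums{Zeros,Remainder,Identity,Averages,Bookkeeping}.lean` →
`GRHTwistedCharacterPrimeSums.lean` (the `t`-uniform Montgomery–Vaughan (13.19)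
`|∑_{n ≤ x} χ(n)Λ(n)n^{-it}| ≪ √x log x · log(q(|t|+2)x)` under RH, by Abel summation of the PROVED truncated
explicit formula `truncatedExplicitFormula_psiChar_holds` (MV Thm. 12.10) with both endpoints averaged so that
only ONE factor `log(q(|t|+2)x)` appears) → `GRHTwistedCharacterPrimeSumsPrimes.lean` (twisted (13.20)–(13.21)
and a second partial summation) → `GRHSmoothEulerProductLemmas.lean`, `GRHSmoothEulerProductLindelof.lean`
(`log|L(s,χ;y)| ≤ |∑_{p ≤ y} χ(p)p^{-s}| + O_ε(1) ≤ (ε/2) log(q(|t|+2)) + O_ε(1)` after passing to the primitive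
character). The only hypothesis is GRH itself.
-/

-- `Summit.<Summit>.<Problem>` is the mandated summit-side namespace (CONVENTIONS §2); for the
-- single-conjunct summit `ABC` the two coincide, so the duplicate `ABC.ABC` is deliberate.
set_option linter.dupNamespace false

noncomputable section

namespace Summit.ABC.ABC.Theorems.TameLocalReceptacle

open Literature.NumberTheory.LFunctions Literature.NumberTheory.Sieve Literature.NumberTheory.Sieve.TwistedWeight

/-- **Stub `stub_smoothLLindelof_of_grh` (Lagarias–Soundararajan 2012, Prop. 5.1, derived in the tree).**
Under the Generalized Riemann Hypothesis the partial Euler products `L(s, χ; y)` of non-principal characters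
satisfy the Lindelöf-type bound `SmoothLLindelof`: for every `ε > 0` there is `C > 0` with
`‖L(s, χ; y)‖ ≤ C (q(1 + |Im s|))^ε` whenever `q ≠ 0`, `χ ≠ 1` mod `q`, `Re s ≥ 1/2 + ε`
(`Literature.NumberTheory.LFunctions.GRHSmoothEulerProduct.smoothLC_lindelof_of_grh`). -/
theorem stub_smoothLLindelof_of_grh : GeneralizedRiemannHypothesis → SmoothLLindelof :=
  fun hGRH _ hε ↦ GRHSmoothEulerProduct.smoothLC_lindelof_of_grh hGRH hε

end Summit.ABC.ABC.Theorems.TameLocalReceptacle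

end
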